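import Mathlib
import HarnessLib
import Summits.HubbardSuperconductivity.HubbardSuperconductivity.Theorems.KLProgrammeKLRegimeTwoVolumeTowerFamStepSecDecay
import Summits.HubbardSuperconductivity.HubbardSuperconductivity.Theorems.KLProgrammeKLRegimeTwoVolumeTowerCovStepSecDecay
import Summits.HubbardSuperconductivity.HubbardSuperconductivity.Theorems.KLProgrammeKLRegimeTwoVolumeTowerStepCovFlowData
import Summits.HubbardSuperconductivity.HubbardSuperconductivity.Theorems.KLProgrammeKLRegimeAlphaWtFlowDeep

/-!
# K3 VL child `KLRegimeVolumeLimitV17F2` (stmt-HubbardSuperconductivity-20440), located item #23 «W2-HALF-VL», COV/SEC shallow half, part 3S (SECTIONAL FLOW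
# STEP): the SECTIONAL `(1 + Λ_w·tnorm)`-rows of the family piece `Fam_i` and the covariance piece `Cov_i` of the tower's step covariance ALONG THE FLOW
# `K_i = klFlowFrameU L M β U μ i`, on ANY lattice `V` (`klEngL₃ ≤ V`), at depth `2k+6 ≤ i < n`: `≤ 𝒦/(Λ_{k+2}²·4^i)` whenever `Λ_w·4^i ≤ ρ_w` — ε-FREE,
# `𝒦, ρ_w` ABSOLUTE

Cell `gate-hubbard-kl`, seat p3 (g16), lead of #23.  The fixed-time twin of part 3 (`stepCov_pieces_flow`): parts 2FS/2CS (`famStepSec_decay_le`,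
`covStepSec_decay_le`) at the consecutive flow frames with every input read off `HistP klPredsV17F2 … 0 n` exactly as there (`β ≤ M` from the history's own
lattice, so no `klEngM₃ β U V ≤ M` is needed).  These are the sectional pieces `φ i`, `ψ i` of the shallow-half door `scaleCovSecData_klStepCov_flow_of_pieces`
(p603893).

* **`stepCovSec_pieces_flow`** — the two sectional bounds, decaying like `4^{−i}`.

Everything is proved; no definitions, no sorry.  Nothing asserts any stub, K3, VL or superconductivity. [cite: BenfattoGiulianiMastropietro2006, §2.8 (2.81), §3 (3.2)–(3.8)]
-/

noncomputable section

namespace Summit.HubbardSuperconductivity.HubbardSuperconductivity.Theorems.TorusFourierL2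

set_option linter.dupNamespace false -- summit = problem name (single-conjunct summit), D-0017

open Set Finset Literature.MathematicalPhysics.QuantumLattice Literature.MathematicalPhysics.QuantumLattice.BandSectorCounting Literature.Probability.LatticeModels
open Literature.MathematicalPhysics.QuantumLattice.FermiRG Literature.Analysis.SpecialFunctions Summit.HubbardSuperconductivity.HubbardSuperconductivity.Theorems.DispersionFlow
open Summit.HubbardSuperconductivity.HubbardSuperconductivity.Theorems.KLRegimeSplit Summit.HubbardSuperconductivity.HubbardSuperconductivity.Theorems.KLProgrammeLegKernels
open Summit.HubbardSuperconductivity.HubbardSuperconductivity.Theorems.PerturbedFermiCurve Summit.HubbardSuperconductivity.HubbardSuperconductivity.Theorems.KLRegimeWick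
open scoped Real Nat

set_option maxHeartbeats 4000000 in
/-- **The SECTIONAL family and covariance pieces of the tower's step covariance along the flow, decaying currency** (module docstring).
[cite: BenfattoGiulianiMastropietro2006, §2.8 (2.81), §3 (3.2)–(3.8)] -/
theorem stepCovSec_pieces_flow :
    ∃ 𝒦 ρw : ℝ, 0 ≤ 𝒦 ∧ 0 < ρw ∧ ρw ≤ 1 ∧
      ∀ (G : GeoConsts) (P : SplitConsts) (R : RenConsts) (Q : EngConsts) (cc : ℝ), R.WF2 → 0 < cc → cc ≤ EngineV8.klEngC₃6 P R →
      ∀ μ ∈ klWindowC, ∀ U : ℝ, 0 < U → U ≤ min (EngineV8.klEngU₀3 P R cc) (1 / (R.Gfr 3 + 1)) →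
      ∀ β : ℝ, klBetaMin ≤ β → β ≤ Real.exp (cc / U ^ 2) →
      ∀ (L M : ℕ) [NeZero L] [NeZero M], EngineV8.klEngL₃ β U ≤ L → EngineV8.klEngM₃ β U L ≤ M →
      ∀ n : ℕ, n ≤ nScales β + 1 → HistP klPredsV17F2 L M G P Q R β U μ 0 n →
        ∀ (V : ℕ) [NeZero V], EngineV8.klEngL₃ β U ≤ V →
        ∀ k : ℕ, 1 ≤ k → k + 2 ≤ nScales β + 1 → ∀ i : ℕ, 2 * k + 6 ≤ i → i + 1 ≤ n → ∀ Λw : ℝ, 0 ≤ Λw → Λw * (4 : ℝ) ^ i ≤ ρw →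
        (∀ (X : SpaceTimeIdx V M × SectorLeg (sectorCount k)) (t : ImagTimeIdx M) (ℓ : SectorLeg (sectorCount k)), ∑ y : TorusSite 2 V,
          ‖((sectorSubMatrix V M β (bgmFatMultiplier V M klE0 β (nambuXiCT V μ (klFlowFrameU L M β U μ i)) k)).transpose *
            hubbardCovSliceCT V M β μ 0 (klFlowFrameU L M β U μ (i + 1)) (klScale klE0 (k + 2)) (klScale klE0 (k + 1)) *
            sectorSubMatrix V M β (bgmFatMultiplier V M klE0 β (nambuXiCT V μ (klFlowFrameU L M β U μ i)) k) -
          (sectorSubMatrix V M β (bgmFatMultiplier V M klE0 β (nambuXiCT V μ (klFlowFrameU L M β U μ (i + 1))) k)).transpose *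
            hubbardCovSliceCT V M β μ 0 (klFlowFrameU L M β U μ (i + 1)) (klScale klE0 (k + 2)) (klScale klE0 (k + 1)) *
            sectorSubMatrix V M β (bgmFatMultiplier V M klE0 β (nambuXiCT V μ (klFlowFrameU L M β U μ (i + 1))) k)) X ((t, y), ℓ)‖ *
            (1 + Λw * (Torus.tnorm (X.1.2 - y) : ℝ)) ≤ 𝒦 / (klScale klE0 (k + 2) ^ 2 * (4 : ℝ) ^ i)) ∧
        (∀ (X : SpaceTimeIdx V M × SectorLeg (sectorCount k)) (t : ImagTimeIdx M) (ℓ : SectorLeg (sectorCount k)), ∑ y : TorusSite 2 V,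
          ‖((sectorSubMatrix V M β (bgmFatMultiplier V M klE0 β (nambuXiCT V μ (klFlowFrameU L M β U μ i)) k)).transpose *
          (hubbardCovSliceCT V M β μ 0 (klFlowFrameU L M β U μ (i + 1)) (klScale klE0 (k + 2)) (klScale klE0 (k + 1)) -
            hubbardCovSliceCT V M β μ 0 (klFlowFrameU L M β U μ i) (klScale klE0 (k + 2)) (klScale klE0 (k + 1))) *
          sectorSubMatrix V M β (bgmFatMultiplier V M klE0 β (nambuXiCT V μ (klFlowFrameU L M β U μ i)) k)) X ((t, y), ℓ)‖ *
            (1 + Λw * (Torus.tnorm (X.1.2 - y) : ℝ)) ≤ 𝒦 / (klScale klE0 (k + 2) ^ 2 * (4 : ℝ) ^ i)) := by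
  have ha : (-4 : ℝ) < -(6 / 5) := by norm_num
  have hab : (-(6 / 5) : ℝ) ≤ -(1 / 10) := by norm_num
  have hb : (-(1 / 10) : ℝ) < 0 := by norm_num
  obtain ⟨𝒦F, ρF, h𝒦F, hρF, hF⟩ := famStepSec_decay_le ha hab hb 2
  obtain ⟨𝒦C, ρC, h𝒦C, hρC, hC⟩ := covStepSec_decay_le ha hab hb 2
  refine ⟨𝒦F + 𝒦C, min (min ρF ρC) 1, by positivity, lt_min (lt_min hρF hρC) one_pos, min_le_right _ _, ?_⟩
  intro G P R Q cc hR2 hcc hcc6 μ hμ U hU hUle β hβmin hβc L M _ _ hL3 hM3 n hnN hhist V _ hV3 k hk hkN i hki hin Λw hΛw0 hΛwρ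
  have hRj : ∀ i, 0 ≤ R.Gfr i := EngineV8.gfr_nonneg_of_wf2 hR2
  have hcle := (hcc6.trans (EngineV8.klEngC₃6_le_klEngC₃3 P R)).trans (EngineV8.klEngC₃3_le_symbolC₃ ha hab hb P hRj)
  have hU3 := (hUle.trans (min_le_left _ _)).trans (EngineV8.klEngU₀3_le_symbolU₀ ha hab hb P hRj cc)
  have hU₀ : U ≤ EngineV8.klEngU₀3 P R cc := hUle.trans (min_le_left _ _)
  have hUG : U ≤ 1 / (R.Gfr 3 + 1) := hUle.trans (min_le_right _ _)
  have hGU : R.Gfr 3 * U ≤ 1 := by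
    have hG3 := hRj 3
    calc R.Gfr 3 * U ≤ R.Gfr 3 * (1 / (R.Gfr 3 + 1)) := mul_le_mul_of_nonneg_left hUG hG3
      _ = R.Gfr 3 / (R.Gfr 3 + 1) := by ring
      _ ≤ 1 := by rw [div_le_one (by positivity)]; linarith only [hG3]
  have hLβ : β ^ 2 ≤ (V : ℝ) := EngineV8.sq_le_of_klEngL₃_le hV3
  have hMβ : β ≤ (M : ℝ) := EngineV8.le_of_klEngM₃_le hβmin hL3 hM3
  obtain ⟨hG₀pos, hG₀1⟩ := sumGfr_mul_le_one_of_le_klEngU₀3 P hRj hU hU₀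
  have hU1 : U ≤ 1 := hU3.trans (min_le_left _ _)
  -- the two consecutive flow frames from the history
  have hi1 : 1 ≤ i := by omega
  obtain ⟨hfr1, hfr2, h3s1, h3s2, -, -, hJi, -⟩ := thinPair_flow_frames hR2 hnN hhist hi1 hin
  have hh := (histP_klPredsV17F2_iff L M G P Q R β U μ 0 n).1 hhist
  have hJ : ∀ m' ≤ i, FlowPieceJetsAt L M β U μ R m' := fun m' hm' => (hh m' (by omega)).2.1.2.1
  have hl3i : ∀ p : Momentum, ‖iteratedFDeriv ℝ 3 (frameLevel μ (klFlowFrameU L M β U μ i)) p‖ ≤ 64 + R.Gfr 3 * U ^ 2 * ((4 : ℝ) ^ i / 3) :=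
    norm_iteratedFDeriv_three_frameLevel_klFlowFrameU_le hRj (fun m' hm' => hJ m' (by omega))
  have hl3i1 : ∀ p : Momentum, ‖iteratedFDeriv ℝ 3 (frameLevel μ (klFlowFrameU L M β U μ (i + 1))) p‖ ≤ 64 + R.Gfr 3 * U ^ 2 * ((4 : ℝ) ^ (i + 1) / 3) :=
    norm_iteratedFDeriv_three_frameLevel_klFlowFrameU_le hRj (fun m' hm' => hJ m' (by omega))
  obtain ⟨hw₀, hw₁, hw₂, hw₃⟩ := flowPiece_increment_jets_G₀ (L := L) (M := M) (μ := μ) hRj hU hU1 hJi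
  -- the indices: `k = m + 1`, offset `j = 2`, depth `4^6·16^{m+1} = 4^{2k+6} ≤ 4^i`
  obtain ⟨m, rfl⟩ : ∃ m, k = m + 1 := ⟨k - 1, by omega⟩
  have hnfN : m + 1 + 2 ≤ nScales β + 1 := by omega
  have hwin : (4 : ℝ) ^ (2 + 4) * (16 : ℝ) ^ (m + 1) ≤ (4 : ℝ) ^ i := by
    rw [show (16 : ℝ) ^ (m + 1) = (4 : ℝ) ^ (2 * (m + 1)) by rw [pow_mul]; norm_num, ← pow_add]
    exact pow_le_pow_right₀ (by norm_num) (by omega)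
  have hnwF : Λw * (4 : ℝ) ^ i ≤ ρF := hΛwρ.trans ((min_le_left _ _).trans (min_le_left _ _))
  have hnwC : Λw * (4 : ℝ) ^ i ≤ ρC := hΛwρ.trans ((min_le_left _ _).trans (min_le_right _ _))
  have hFs := hF R hRj cc U hcc hcle hU hU3 hGU β hβmin hβc μ hμ V M hLβ hMβ _ _ i hfr1 hfr2 h3s1 h3s2 hl3i hl3i1 _ hG₀pos hG₀1 hw₀ hw₁ hw₂ hw₃
    m hnfN hwin Λw hΛw0 hnwF
  have hCs := hC R hRj cc U hcc hcle hU hU3 hGU β hβmin hβc μ hμ V M hLβ hMβ _ _ i hfr1 hfr2 h3s1 h3s2 hl3i hl3i1 _ hG₀pos hG₀1 hw₀ hw₁ hw₂ hw₃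
    m hnfN hwin Λw hΛw0 hnwC
  -- `𝒦_F·G₀ ≤ 𝒦_F + 𝒦_C`, `𝒦_C·G₀ ≤ 𝒦_F + 𝒦_C`
  have hX : 0 ≤ 1 / (klScale klE0 (m + 1 + 2) ^ 2 * (4 : ℝ) ^ i) := by positivity
  have e12 : m + 1 + 1 = m + 2 := rfl
  simp only [e12]
  have kF : 𝒦F * ((R.Gfr 0 + R.Gfr 1 + R.Gfr 2 + R.Gfr 3 + 1) * U) / (klScale klE0 (m + 1 + 2) ^ 2 * (4 : ℝ) ^ i) ≤
      (𝒦F + 𝒦C) / (klScale klE0 (m + 1 + 2) ^ 2 * (4 : ℝ) ^ i) := by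
    refine div_le_div_of_nonneg_right ?_ (by positivity)
    nlinarith only [h𝒦F, h𝒦C, hG₀1, hG₀pos]
  have kC : 𝒦C * ((R.Gfr 0 + R.Gfr 1 + R.Gfr 2 + R.Gfr 3 + 1) * U) / (klScale klE0 (m + 1 + 2) ^ 2 * (4 : ℝ) ^ i) ≤
      (𝒦F + 𝒦C) / (klScale klE0 (m + 1 + 2) ^ 2 * (4 : ℝ) ^ i) := by
    refine div_le_div_of_nonneg_right ?_ (by positivity)
    nlinarith only [h𝒦F, h𝒦C, hG₀1, hG₀pos]
  exact ⟨fun X t ℓ => (hFs X t ℓ).trans kF, fun X t ℓ => (hCs X t ℓ).trans kC⟩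

end Summit.HubbardSuperconductivity.HubbardSuperconductivity.Theorems.TorusFourierL2

end
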